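import Literature.Computability.QuantumComplexity.AaronsonAmbainisSimTreeBounds
import Literature.Computability.QuantumComplexity.PseudoBounded
import HarnessLib

/-!
# Crux `TransferPB` (stmt-QuantumAdvantage-15238, route SosSandwich), line `birth` — Aaronson–Ambainis' Thm 21 under an influence hypothesis on a RESTRICTION-CLOSED CLASS

Toward stub `stub_pbOracleSimulation` (`Sig.stub_pbOracleSimulation : Sig.stub_oracleAcceptPseudoBounded →
PseudoBoundedAA → OracleSimulation`): the crux replaces Aaronson–Ambainis' Conjecture 6 (for ALL bounded
low-degree polynomials) by PB-AA (for the SOS sandwich class `K_T` only), "observing that the influence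
hypothesis is only ever applied to RESTRICTIONS OF ACCEPTANCE POLYNOMIALS … which are pseudo-bounded of order
`T`". The tree's analysis of the classical simulation `ClassicalSimulation.simTree` (Aaronson–Ambainis 2014,
Thm. 21 = ToC Thm. 3.3; `AaronsonAmbainisProofs.lean`: `sum_cost_simTree_mul_le`, `haltError_simTree_le`;
`AaronsonAmbainisSimTreeBounds.lean`: `simTree_depth_error_le`) takes the influence hypothesis for EVERY
bounded polynomial of degree `≤ d`. This file re-runs that analysis — same algorithm, same constants, same
proof — with the hypothesis demanded only on a class `K` of polynomials that is CLOSED UNDER RESTRICTION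
(`restrictPoly`) and contains the input polynomial:

* `sum_cost_simTree_mul_le_of_inv`, `haltError_simTree_le_of_inv` — the potential argument and the
  Chebyshev bound at halting leaves, with the invariant `K`;
* **`simTree_depth_error_le_of_inv`** — Thm. 21, explicit form, for `p ∈ K`: depth
  `≤ (⌈16·4^c/C⌉ + 1)(d/(εδ) + 1)^{4c+2}` and `ε`-accuracy on all but `≤ δ·2^N` inputs, granted the influence
  bound `C (ε/d)^c` on the members of `K` of degree `≤ d` with values in `[0,1]`;
* `pseudoBounded_restrictPoly` — `K_T` is such a class (`PseudoBounded.restrict`, the route's support item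
  `PseudoBoundedRestrict`, with `restrictPoly = bind₁`), and **`simTree_depth_error_le_pb`** — Thm. 21 for
  `p ∈ K_T` of degree `≤ d`, `T ≤ d`, granted the PB-AA influence bound at order `d`.

All proved; no named fact; nothing of the route is restated (PB-AA enters the downstream files by name).
Source: S. Aaronson, A. Ambainis, *The need for structure in quantum speedups*, Theory Comput. 10 (2014),
Thm. 21 (arXiv:0911.0996v3 pp. 13–14) and proof of Thm. 23 (p. 14).
-/

-- D-0017: single-conjunct summit ⇒ the duplicate `QuantumAdvantage.QuantumAdvantage` is mandated.
set_option linter.dupNamespace false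

noncomputable section

namespace Summit.QuantumAdvantage.QuantumAdvantage.Cruxes.TransferPB.Birth

open Finset Literature.Computability.QuantumComplexity Literature.Computability.QuantumComplexity.ClassicalSimulation

namespace SimTreePB

variable {N : ℕ} (θ w : ℝ) (d : ℕ) (K : MvPolynomial (Fin N) ℝ → Prop)

/-- **Expected number of queries, invariant form** (the potential argument of Thm. 21): if `K` is closed
under restriction and every `q ∈ K` of degree `≤ d` with values in `[0,1]` and `Var[q] > θ` has a variable of
influence `≥ w`, then for `p ∈ K`, `w · ∑_x #queries(x) ≤ 2^N · Inf[p]`. Proof verbatim as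
`ClassicalSimulation.sum_cost_simTree_mul_le`, carrying `K` along. [cite: AaronsonAmbainis2014, Thm. 21 (proof, pp. 13–14)] -/
theorem sum_cost_simTree_mul_le_of_inv (hK : ∀ (q : MvPolynomial (Fin N) ℝ) (i : Fin N) (b : Bool),
      K q → K (restrictPoly i b q)) (hw : 0 < w)
    (hAA : ∀ q : MvPolynomial (Fin N) ℝ, K q → q.totalDegree ≤ d →
      (∀ x, 0 ≤ evalBool q x ∧ evalBool q x ≤ 1) → θ < boolVariance q → ∃ i, w ≤ influence i q) :
    ∀ (D : ℕ) (p : MvPolynomial (Fin N) ℝ), K p → p.totalDegree ≤ d →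
      (∀ x, 0 ≤ evalBool p x ∧ evalBool p x ≤ 1) →
        (∑ x, ((simTree θ w D p).cost x : ℝ)) * w ≤ 2 ^ N * ∑ j, influence j p
  | 0, p, _, _, _ => by
    simp only [simTree, RealDecisionTree.cost_leaf, Nat.cast_zero, Finset.sum_const_zero, zero_mul]
    exact mul_nonneg (by positivity) (Finset.sum_nonneg fun j _ => influence_nonneg j p)
  | D + 1, p, hKp, hdeg, hbd => by
    by_cases h : boolVariance p ≤ θ
    · rw [simTree_succ_of_le θ w h]
      simp only [RealDecisionTree.cost_leaf, Nat.cast_zero, Finset.sum_const_zero, zero_mul]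
      exact mul_nonneg (by positivity) (Finset.sum_nonneg fun j _ => influence_nonneg j p)
    · cases hp : pickVar w p with
      | none => exact absurd hp (pickVar_ne_none (hAA p hKp hdeg hbd (lt_of_not_ge h)))
      | some i =>
        rw [simTree_succ_of_some θ w h hp]
        set T0 := simTree θ w D (restrictPoly i false p) with hT0
        set T1 := simTree θ w D (restrictPoly i true p) with hT1
        have IH0 := sum_cost_simTree_mul_le_of_inv hK hw hAA D (restrictPoly i false p) (hK p i false hKp)
          ((totalDegree_restrictPoly_le i false p).trans hdeg) (restrictPoly_bound hbd i false)
        have IH1 := sum_cost_simTree_mul_le_of_inv hK hw hAA D (restrictPoly i true p) (hK p i true hKp)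
          ((totalDegree_restrictPoly_le i true p).trans hdeg) (restrictPoly_bound hbd i true)
        rw [← hT0] at IH0
        rw [← hT1] at IH1
        have hinv0 : ∀ x, (T0.cost (flipBit i x) : ℝ) = T0.cost x := fun x => by
          rw [(simTree_flipBit θ w hw i D (restrictPoly i false p)
            (evalBool_restrictPoly_flipBit i false p) x).2]
        have hinv1 : ∀ x, (T1.cost (flipBit i x) : ℝ) = T1.cost x := fun x => by
          rw [(simTree_flipBit θ w hw i D (restrictPoly i true p)
            (evalBool_restrictPoly_flipBit i true p) x).2]
        have hsplit : ∑ x : Fin N → Bool, (((if x i then T1.cost x else T0.cost x) + 1 : ℕ) : ℝ) =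
            (∑ x, (T0.cost x : ℝ)) / 2 + (∑ x, (T1.cost x : ℝ)) / 2 + 2 ^ N := by
          rw [← sum_ite_apply_eq_half i false hinv0, ← sum_ite_apply_eq_half i true hinv1,
            ← Finset.sum_add_distrib, ← mul_one ((2 : ℝ) ^ N), ← sum_const_cube,
            ← Finset.sum_add_distrib]
          refine Finset.sum_congr rfl fun x _ => ?_
          cases x i <;> simp
        have hkey : (2 : ℝ) ^ N * ∑ j, influence j (restrictPoly i false p) +
            2 ^ N * ∑ j, influence j (restrictPoly i true p) =
              2 ^ N * (2 * (∑ j, influence j p - influence i p)) := by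
          rw [← mul_add, sum_influence_restrictPoly_add]
        have hwi : (2 : ℝ) ^ N * w ≤ 2 ^ N * influence i p :=
          mul_le_mul_of_nonneg_left (le_influence_of_pickVar hp) (by positivity)
        simp only [RealDecisionTree.cost_query]
        rw [hsplit]
        nlinarith [IH0, IH1, hkey, hwi]

variable (ε : ℝ)

/-- **Correctness when halting, invariant form** (Chebyshev at the halting leaves): for `p ∈ K`, the inputs
whose path halts within the budget and whose output errs by more than `ε` number at most `2^N θ/ε²`. Proof
verbatim as `ClassicalSimulation.haltError_simTree_le`, carrying `K` along. [cite: AaronsonAmbainis2014, Thm. 21 (proof, pp. 13–14)] -/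
theorem haltError_simTree_le_of_inv (hK : ∀ (q : MvPolynomial (Fin N) ℝ) (i : Fin N) (b : Bool),
      K q → K (restrictPoly i b q)) (hw : 0 < w) (hθ : 0 ≤ θ) (hε : 0 < ε)
    (hAA : ∀ q : MvPolynomial (Fin N) ℝ, K q → q.totalDegree ≤ d →
      (∀ x, 0 ≤ evalBool q x ∧ evalBool q x ≤ 1) → θ < boolVariance q → ∃ i, w ≤ influence i q) :
    ∀ (D : ℕ) (p : MvPolynomial (Fin N) ℝ), K p → p.totalDegree ≤ d →
      (∀ x, 0 ≤ evalBool p x ∧ evalBool p x ≤ 1) →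
        (∑ x, if (simTree θ w D p).cost x < D ∧ ε < |(simTree θ w D p).eval x - evalBool p x|
          then (1 : ℝ) else 0) * ε ^ 2 ≤ 2 ^ N * θ
  | 0, p, _, _, _ => by
    simp only [Nat.not_lt_zero, false_and, if_false, Finset.sum_const_zero, zero_mul]
    positivity
  | D + 1, p, hKp, hdeg, hbd => by
    by_cases h : boolVariance p ≤ θ
    · rw [simTree_succ_of_le θ w h]
      simp only [RealDecisionTree.cost_leaf, Nat.zero_lt_succ, true_and,
        RealDecisionTree.eval_leaf]
      calc (∑ x, if ε < |boolAvg (evalBool p) - evalBool p x| then (1 : ℝ) else 0) * ε ^ 2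
          = ∑ x, (if ε < |boolAvg (evalBool p) - evalBool p x| then ε ^ 2 else 0) := by
            rw [Finset.sum_mul]
            refine Finset.sum_congr rfl fun x _ => ?_
            split_ifs <;> simp
        _ ≤ ∑ x, (evalBool p x - boolAvg (evalBool p)) ^ 2 := by
            refine Finset.sum_le_sum fun x _ => ?_
            split_ifs with hx
            · have h1 : ε ^ 2 ≤ |boolAvg (evalBool p) - evalBool p x| ^ 2 :=
                pow_le_pow_left₀ hε.le hx.le 2
              rw [sq_abs] at h1
              nlinarith [h1]
            · positivity
        _ = 2 ^ N * boolVariance p := by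
            have h2 : (2 : ℝ) ^ N ≠ 0 := by positivity
            have hmul : ∀ s : ℝ, 2 ^ N * (s / 2 ^ N) = s := fun s => mul_div_cancel₀ s h2
            show _ = 2 ^ N * ((∑ x, (evalBool p x - boolAvg (evalBool p)) ^ 2) / 2 ^ N)
            rw [hmul]
        _ ≤ 2 ^ N * θ := by gcongr
    · cases hp : pickVar w p with
      | none => exact absurd hp (pickVar_ne_none (hAA p hKp hdeg hbd (lt_of_not_ge h)))
      | some i =>
        rw [simTree_succ_of_some θ w h hp]
        set T0 := simTree θ w D (restrictPoly i false p) with hT0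
        set T1 := simTree θ w D (restrictPoly i true p) with hT1
        have IH0 := haltError_simTree_le_of_inv hK hw hθ hε hAA D (restrictPoly i false p) (hK p i false hKp)
          ((totalDegree_restrictPoly_le i false p).trans hdeg) (restrictPoly_bound hbd i false)
        have IH1 := haltError_simTree_le_of_inv hK hw hθ hε hAA D (restrictPoly i true p) (hK p i true hKp)
          ((totalDegree_restrictPoly_le i true p).trans hdeg) (restrictPoly_bound hbd i true)
        rw [← hT0] at IH0
        rw [← hT1] at IH1
        set G0 : (Fin N → Bool) → ℝ := fun x =>
          if T0.cost x < D ∧ ε < |T0.eval x - evalBool (restrictPoly i false p) x|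
            then (1 : ℝ) else 0 with hG0
        set G1 : (Fin N → Bool) → ℝ := fun x =>
          if T1.cost x < D ∧ ε < |T1.eval x - evalBool (restrictPoly i true p) x|
            then (1 : ℝ) else 0 with hG1
        have hinv0 : ∀ x, G0 (flipBit i x) = G0 x := fun x => by
          have hf := simTree_flipBit θ w hw i D (restrictPoly i false p)
            (evalBool_restrictPoly_flipBit i false p) x
          simp only [hG0]
          rw [hf.1, hf.2, evalBool_restrictPoly_flipBit]
        have hinv1 : ∀ x, G1 (flipBit i x) = G1 x := fun x => by
          have hf := simTree_flipBit θ w hw i D (restrictPoly i true p)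
            (evalBool_restrictPoly_flipBit i true p) x
          simp only [hG1]
          rw [hf.1, hf.2, evalBool_restrictPoly_flipBit]
        have hpt : ∀ x : Fin N → Bool,
            (if (RealDecisionTree.query i T0 T1).cost x < D + 1 ∧
                ε < |(RealDecisionTree.query i T0 T1).eval x - evalBool p x| then (1 : ℝ) else 0) =
              (if x i = false then G0 x else 0) + (if x i = true then G1 x else 0) := by
          intro x
          simp only [RealDecisionTree.cost_query, RealDecisionTree.eval_query, hG0, hG1]
          by_cases hxi : x i = true
          · have hx : Function.update x i true = x := by rw [← hxi, Function.update_eq_self]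
            simp [evalBool_restrictPoly, hx, hxi]
          · have hxi' : x i = false := by simpa using hxi
            have hx : Function.update x i false = x := by rw [← hxi', Function.update_eq_self]
            simp [evalBool_restrictPoly, hx, hxi']
        rw [Finset.sum_congr rfl (fun x _ => hpt x), Finset.sum_add_distrib,
          sum_ite_apply_eq_half i false hinv0, sum_ite_apply_eq_half i true hinv1]
        nlinarith [IH0, IH1]

variable {θ w d ε K}

/-- **Aaronson–Ambainis' Thm. 21 for `p` in a restriction-closed class `K` — explicit form.** Let `c, C > 0`
and suppose every `q ∈ K` of degree `≤ d` (`d ≥ 1`) with values in `[0,1]` and `Var[q] ≥ ε' > 0` has a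
variable of influence `≥ C (ε'/d)^c`. Then for `p ∈ K` of degree `≤ d` with values in `[0,1]` and
`ε, δ ∈ (0,1]`, the tree `simTree (ε²δ/2) (C((ε²δ/2)/d)^c) ⌈8d/(wδ)⌉ p` has depth
`≤ (⌈16·4^c/C⌉ + 1)(d/(εδ) + 1)^{4c+2}` and is `ε`-accurate on all but `≤ δ·2^N` inputs. Proof verbatim as
`ClassicalSimulation.simTree_depth_error_le` with the invariant forms of the two counting lemmas.
[cite: AaronsonAmbainis2014, Thm. 21 (proof, pp. 13–14)] -/
theorem simTree_depth_error_le_of_inv {c : ℕ} {C : ℝ} (hC : 0 < C) {N d : ℕ} (hd1 : 1 ≤ d)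
    {K : MvPolynomial (Fin N) ℝ → Prop}
    (hK : ∀ (q : MvPolynomial (Fin N) ℝ) (i : Fin N) (b : Bool), K q → K (restrictPoly i b q))
    (H : ∀ (q : MvPolynomial (Fin N) ℝ) (ε : ℝ), K q → q.totalDegree ≤ d →
      (∀ x, 0 ≤ evalBool q x ∧ evalBool q x ≤ 1) → 0 < ε → ε ≤ boolVariance q →
        ∃ i : Fin N, C * (ε / d) ^ c ≤ influence i q)
    {p : MvPolynomial (Fin N) ℝ} (hKp : K p) (hdeg : p.totalDegree ≤ d)
    (hbd : ∀ x, 0 ≤ evalBool p x ∧ evalBool p x ≤ 1) {ε δ : ℝ} (hε : 0 < ε) (hε1 : ε ≤ 1)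
    (hδ : 0 < δ) (hδ1 : δ ≤ 1) :
    ((simTree (ε ^ 2 * δ / 2) (C * ((ε ^ 2 * δ / 2) / d) ^ c)
        (Nat.ceil (8 * (d : ℝ) / ((C * ((ε ^ 2 * δ / 2) / d) ^ c) * δ))) p).depth : ℝ) ≤
        (Nat.ceil (16 * 2 ^ c * 2 ^ c / C) + 1 : ℕ) * ((d : ℝ) / (ε * δ) + 1) ^ (4 * c + 2) ∧
      ((univ.filter fun x : Fin N → Bool => ε <
          |(simTree (ε ^ 2 * δ / 2) (C * ((ε ^ 2 * δ / 2) / d) ^ c)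
              (Nat.ceil (8 * (d : ℝ) / ((C * ((ε ^ 2 * δ / 2) / d) ^ c) * δ))) p).eval x -
            evalBool p x|).card : ℝ) ≤ δ * 2 ^ N := by
  set u : ℝ := (d : ℝ) / (ε * δ) + 1 with hu
  have hu0 : 0 < u := by positivity
  have hdpos : (0 : ℝ) < d := by exact_mod_cast hd1
  have hd1' : (1 : ℝ) ≤ d := by exact_mod_cast hd1
  set θ : ℝ := ε ^ 2 * δ / 2 with hθ
  have hθpos : 0 < θ := by positivity
  set w : ℝ := C * (θ / d) ^ c with hw
  have hwpos : 0 < w := by positivity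
  have hAA' : ∀ q : MvPolynomial (Fin N) ℝ, K q → q.totalDegree ≤ d →
      (∀ x, 0 ≤ evalBool q x ∧ evalBool q x ≤ 1) → θ < boolVariance q →
        ∃ i, w ≤ influence i q :=
    fun q hKq hq hqb hθq => H q θ hKq hq hqb hθpos hθq.le
  set D : ℕ := Nat.ceil (8 * d / (w * δ)) with hD
  have hDge : 8 * d / (w * δ) ≤ D := Nat.le_ceil _
  have hbudget : 0 < 8 * d / (w * δ) := by positivity
  have hεδ : 0 < ε * δ := mul_pos hε hδ
  have hεδ1 : ε * δ ≤ 1 := mul_le_one₀ hε1 hδ.le hδ1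
  have hprod : ε * δ * u = d + ε * δ := by
    rw [hu]
    field_simp
  have hεu : 1 ≤ ε * u := by
    have h1 : 0 ≤ ε * u * (1 - δ) := mul_nonneg (by positivity) (by linarith)
    nlinarith
  have hδu : 1 ≤ δ * u := by
    have h1 : 0 ≤ δ * u * (1 - ε) := mul_nonneg (by positivity) (by linarith)
    nlinarith
  have hTu : (d : ℝ) ≤ u := by
    have h1 : 0 ≤ u * (1 - ε * δ) := mul_nonneg hu0.le (by linarith)
    nlinarith
  have hdu : (d : ℝ) ≤ 2 * u := by linarith
  have hθu : 1 ≤ 2 * θ * u ^ 3 := by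
    have : 2 * θ * u ^ 3 = (ε * u) ^ 2 * (δ * u) := by
      rw [hθ]
      ring
    rw [this]
    exact one_le_mul_of_one_le_of_one_le (one_le_pow₀ hεu) hδu
  have hKbound : 8 * (d : ℝ) / (w * δ) ≤ 16 * 2 ^ c * 2 ^ c / C * u ^ (4 * c + 2) := by
    rw [div_le_iff₀ (by positivity)]
    have hC0 : C ≠ 0 := hC.ne'
    have hd0 : (d : ℝ) ≠ 0 := hdpos.ne'
    have hwδ : 16 * 2 ^ c * 2 ^ c / C * u ^ (4 * c + 2) * (w * δ) =
        16 * 2 ^ c * 2 ^ c * u ^ (4 * c + 2) * θ ^ c * δ / (d : ℝ) ^ c := by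
      rw [hw, div_pow]
      field_simp
    rw [hwδ, le_div_iff₀ (by positivity)]
    calc 8 * (d : ℝ) * (d : ℝ) ^ c = 8 * (d : ℝ) ^ (c + 1) := by ring
      _ ≤ _ := queryBudget_arith c hu0.le hdpos.le hdu hθu hδu
  set t := simTree θ w D p with ht
  refine ⟨?_, ?_⟩
  · have hu1 : (1 : ℝ) ≤ u ^ (4 * c + 2) := one_le_pow₀ (by linarith)
    have hceil : 16 * 2 ^ c * 2 ^ c / C ≤ (Nat.ceil (16 * 2 ^ c * 2 ^ c / C) : ℝ) :=
      Nat.le_ceil _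
    calc (t.depth : ℝ) ≤ D := by exact_mod_cast depth_simTree_le θ w D p
      _ ≤ 8 * d / (w * δ) + 1 := (Nat.ceil_lt_add_one hbudget.le).le
      _ ≤ 16 * 2 ^ c * 2 ^ c / C * u ^ (4 * c + 2) + 1 := by linarith
      _ ≤ (Nat.ceil (16 * 2 ^ c * 2 ^ c / C) + 1 : ℕ) * u ^ (4 * c + 2) := by
          have h := mul_le_mul_of_nonneg_right hceil (zero_le_one.trans hu1)
          push_cast
          linarith
  · have hA := sum_cost_simTree_mul_le_of_inv θ w d K hK hwpos hAA' D p hKp hdeg hbd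
    have hB := haltError_simTree_le_of_inv θ w d K ε hK hwpos hθpos.le hε hAA' D p hKp hdeg hbd
    have hM := t.markov_cost D
    rw [← ht] at hA hB
    have hI : ∑ j, influence j p ≤ 4 * d := sum_influence_le hdeg hbd
    have hpt : ∀ x, (if ε < |t.eval x - evalBool p x| then (1 : ℝ) else 0) ≤
        (if t.cost x < D ∧ ε < |t.eval x - evalBool p x| then (1 : ℝ) else 0) +
          (if t.cost x = D then (1 : ℝ) else 0) := by
      intro x
      have hc : t.cost x ≤ D := cost_simTree_le θ w D p x
      rcases hc.lt_or_eq with hlt | heq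
      · by_cases hb : ε < |t.eval x - evalBool p x| <;> simp [hlt, hlt.ne, hb]
      · by_cases hb : ε < |t.eval x - evalBool p x| <;> simp [heq, hb]
    have hcard : ((Finset.univ.filter fun x : Fin N → Bool =>
        ε < |t.eval x - evalBool p x|).card : ℝ) =
          ∑ x, (if ε < |t.eval x - evalBool p x| then (1 : ℝ) else 0) := by
      rw [Finset.natCast_card_filter]
    rw [hcard]
    set S1 : ℝ := ∑ x, (if t.cost x < D ∧ ε < |t.eval x - evalBool p x| then (1 : ℝ) else 0)
      with hS1
    set S2 : ℝ := ∑ x, (if t.cost x = D then (1 : ℝ) else 0) with hS2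
    have hsum : ∑ x, (if ε < |t.eval x - evalBool p x| then (1 : ℝ) else 0) ≤ S1 + S2 := by
      rw [hS1, hS2, ← Finset.sum_add_distrib]
      exact Finset.sum_le_sum fun x _ => hpt x
    have h1 : S1 ≤ 2 ^ N * (δ / 2) := by
      have hε2 : 0 < ε ^ 2 := by positivity
      have : S1 * ε ^ 2 ≤ 2 ^ N * (δ / 2) * ε ^ 2 := by
        calc S1 * ε ^ 2 ≤ 2 ^ N * θ := hB
          _ = 2 ^ N * (δ / 2) * ε ^ 2 := by rw [hθ]; ring
      exact le_of_mul_le_mul_right this hε2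
    have h2 : S2 ≤ 2 ^ N * (δ / 2) := by
      have hS2D : (D : ℝ) * S2 * w ≤ 2 ^ N * (4 * d) := by
        calc (D : ℝ) * S2 * w ≤ (∑ x, (t.cost x : ℝ)) * w :=
              mul_le_mul_of_nonneg_right hM hwpos.le
          _ ≤ 2 ^ N * ∑ j, influence j p := hA
          _ ≤ 2 ^ N * (4 * d) := by gcongr
      have hDw : 8 * d ≤ (D : ℝ) * (w * δ) := (div_le_iff₀ (by positivity)).mp hDge
      have hS2nn : 0 ≤ S2 := Finset.sum_nonneg fun x _ => by positivity
      have h3 : 8 * (d : ℝ) * S2 ≤ (D : ℝ) * (w * δ) * S2 := mul_le_mul_of_nonneg_right hDw hS2nn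
      have h5 : (D : ℝ) * S2 * w * δ ≤ 2 ^ N * (4 * d) * δ :=
        mul_le_mul_of_nonneg_right hS2D hδ.le
      have h7 : S2 * (8 * d) ≤ 2 ^ N * (δ / 2) * (8 * d) := by linarith
      exact le_of_mul_le_mul_right h7 (by positivity)
    linarith

/-! ### The SOS sandwich class is restriction-closed -/

/-- **`K_T` is closed under the simulation's restrictions**: `restrictPoly i b p ∈ K_T` for `p ∈ K_T`
(`PseudoBounded.restrict`, the route's support item `PseudoBoundedRestrict`; `restrictPoly` is the same
substitution `bind₁ = aeval`). [cite: KaniewskiLeeDewolf2015, Thm. 12] -/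
theorem pseudoBounded_restrictPoly {N T : ℕ} {p : MvPolynomial (Fin N) ℝ} (h : PseudoBounded T p)
    (i : Fin N) (b : Bool) : PseudoBounded T (restrictPoly i b p) :=
  h.restrict i b

/-- **Thm. 21 for the SOS sandwich class under the PB-AA influence bound at order `d`.** If every
`q ∈ K_d` (in `N` variables) with `Var[q] ≥ ε' > 0` has a variable of influence `≥ C (ε'/d)^c`, then every
`p ∈ K_T`, `T ≤ d`, `1 ≤ d`, of degree `≤ d` is `ε`-approximated on all but `≤ δ 2^N` inputs by the simulation
tree with the explicit depth bound (members of `K_T ⊆ K_d` take values in `[0,1]`, `PseudoBounded.bounded`).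
[cite: AaronsonAmbainis2014, Thm. 21 (proof, pp. 13–14)] -/
theorem simTree_depth_error_le_pb {c : ℕ} {C : ℝ} (hC : 0 < C) {N d T : ℕ} (hd1 : 1 ≤ d) (hTd : T ≤ d)
    (H : ∀ (q : MvPolynomial (Fin N) ℝ) (ε : ℝ), PseudoBounded d q → 0 < ε → ε ≤ boolVariance q →
        ∃ i : Fin N, C * (ε / d) ^ c ≤ influence i q)
    {p : MvPolynomial (Fin N) ℝ} (hKp : PseudoBounded T p) (hdeg : p.totalDegree ≤ d)
    {ε δ : ℝ} (hε : 0 < ε) (hε1 : ε ≤ 1) (hδ : 0 < δ) (hδ1 : δ ≤ 1) :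
    ((simTree (ε ^ 2 * δ / 2) (C * ((ε ^ 2 * δ / 2) / d) ^ c)
        (Nat.ceil (8 * (d : ℝ) / ((C * ((ε ^ 2 * δ / 2) / d) ^ c) * δ))) p).depth : ℝ) ≤
        (Nat.ceil (16 * 2 ^ c * 2 ^ c / C) + 1 : ℕ) * ((d : ℝ) / (ε * δ) + 1) ^ (4 * c + 2) ∧
      ((univ.filter fun x : Fin N → Bool => ε <
          |(simTree (ε ^ 2 * δ / 2) (C * ((ε ^ 2 * δ / 2) / d) ^ c)
              (Nat.ceil (8 * (d : ℝ) / ((C * ((ε ^ 2 * δ / 2) / d) ^ c) * δ))) p).eval x -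
            evalBool p x|).card : ℝ) ≤ δ * 2 ^ N :=
  simTree_depth_error_le_of_inv hC hd1 (K := PseudoBounded d)
    (fun _ i b hq => pseudoBounded_restrictPoly hq i b)
    (fun q ε' hq _ _ hε' hv => H q ε' hq hε' hv) (hKp.mono hTd) hdeg (hKp.mono hTd).bounded hε hε1 hδ hδ1

end SimTreePB

end Summit.QuantumAdvantage.QuantumAdvantage.Cruxes.TransferPB.Birth

end
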